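import Literature.NumberTheory.Automorphic.ArchRankOneLimitFormulaPartial       -- ★ p841432 (R3-c step 1): the UNSIGNED one-place formula (`C ≠ 0`) + its imports (★ (R1-a), ★ (R1G), ★ (R3-a) weights)
import Literature.NumberTheory.Automorphic.ArchRankOneLimitFormulaGroupSigned   -- ★ (J-sgn) (R1G) SIGNED: `exists_tendsto_deriv_two_sin_smul_orbitalIntegral_neg` (`C < 0` on `U(e₀,e₁)`, `e₀e₁ < 0`)
import HarnessLib

/-!
# Harish-Chandra's rank-one limit formula for MIXED PARTIAL ORBITAL TEST FUNCTIONS, SIGNED: the one-place constant is NEGATIVE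
# (Rogawski 1990 §8.2 p. 119 ∕ p. 123 «the constant in the limit formula for `H′` differs by a sign from that for `H`», §14.5 p. 238; Varadarajan 1989 §6.4 Thm 22)

Topic `NumberTheory/Automorphic`; namespace `Literature.NumberTheory.Automorphic.UnitaryGroup`.  THEOREMS ONLY (no `def`, no instance, no notation, no axiom, no named fact, no `sorry`).
Cell `pub/hodgecm-mathlib`, Track B «K2-LIT» ∕ crux H413 = `stmt-HodgeConjecture-24833`, ENGINE E4 (socket #9 ∕ «signed #9» = #10♯): the SIGN HALF (b) asked by K2E4-p15 (g2)
2026-09-03T22:38:56Z ∕ 22:42:28Z and typed by K2E4-p09 as `HStepDataSigned.C_neg : C < 0` (★ p855382); author K2E4-p13 (g0), 2026-09-03.  BY IMPORT over ★ p841432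
`ArchRankOneLimitFormulaPartial` (its §1 ∕ §2, `C ≠ 0`) and ★ (J-sgn) `ArchRankOneLimitFormulaGroupSigned` (`C < 0` on the group): §1 ∕ §2 of ★ p841432 are re-run TOKEN FOR TOKEN
with the quantifier `C ≠ 0 ↦ C < 0`, the constant being ★ (R1G)'s `C = −2π·C₁(ν) < 0` carried UNCHANGED through ★ (R1-a)'s reading of the mixed partial integral (proofs identical;
the birth lemma is the `_neg` twin) — in a separate module so that ★ p841432 and everything built on it (★ `ArchEndoscopicCentralDescentValue`, ★ `K2E4ArchHStepLaw`, …) is untouched.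

WHY THE SIGN MATTERS (E4 «signed #9», K2E4-p15's ★ p855349 ∕ ★ `K2E4ArchConstantSignWitness`).  The explicit archimedean singular constant is `cinf = κ·∏_w C_w·2^{|W|} ∕ lam`
(★ p855083), `C_w` = the H-step constant at `w` (this file's `C`, via ★ `ArchEndoscopicCentralDescentValue` §5 and ★ `K2E4ArchHStepLaw`); its PHASE law («`cinf ∈ ε(H′)·conj τ_∞·ℝ_{>0}`»)
needs `C_w < 0` at every place — ONE universal sign, the `H`-block being of `U(1,1)`-type at every complex place.

* §1 **`exists_tendsto_deriv_two_sin_smul_integral_integral_insert_neg`** — ★ p841432 §1 VERBATIM with `∃ C : ℝ, C < 0 ∧ …`.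
* §2 **`exists_tendsto_deriv_two_sin_smul_integral_integral_insert_quasiSplitTwo_neg`** — ★ p841432 §2 VERBATIM with `C < 0` (the endoscopic 2-block `β₂ = (½, −½)` at every place).
HONEST LABEL: HC_CM is proved only modulo the 7 printed citations (2 remaining named inputs: hLiu418 = stmt-HodgeConjecture-24832, h413 = stmt-HodgeConjecture-24833) until rung 0 closes;
this file is sign bookkeeping of an in-house theorem and pays nothing by itself.

## References
* [Varadarajan1989] V. S. Varadarajan, *An Introduction to Harmonic Analysis on Semisimple Lie Groups* (1989), §6.4 Thm. 22, Lemma 21 (limit formula, `(1∕i)F′(1) = −π f(1)`).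
* [Rogawski1990] J. D. Rogawski, *Automorphic Representations of Unitary Groups in Three Variables*, Ann. of Math. Stud. 123 (1990), §8.2 Prop. 8.2.1 p. 119, p. 123; §14.5 Lemma 14.5.2 (c)
  p. 238; §8.4 pp. 126–127.
* [HormanderALPDO1] L. Hörmander, *The Analysis of Linear Partial Differential Operators I*, 2nd ed. (1990), Thm. 1.1.9, Thm. 1.4.1.
-/

set_option autoImplicit false

noncomputable section

open MeasureTheory Matrix NumberField NumberField.InfinitePlace NumberField.mixedEmbedding Set Function Filter Topology
open scoped MatrixGroups ContDiff

-- the scoped `L^∞`-operator norm on `M_N(ℂ)` and `M_N(L ⊗ ℝ)`, the cell's ambient-smooth convention (★ `ArchimedeanCalculus`, ★ (V7)-smooth, ★ (R1-a))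
open scoped Matrix.Norms.Operator

namespace Literature.NumberTheory.Automorphic.UnitaryGroup

/-! ## §1 The one-place limit formula for mixed partial orbital test functions, SIGNED -/

section Insert

variable (L : Type) [Field L] [NumberField L] [IsCMField L] (α : Fin 2 → L)
  [∀ w : {w : InfinitePlace L // IsComplex w}, MeasurableSpace (archLocal L 2 (Matrix.diagonal α) w)]
  [∀ w : {w : InfinitePlace L // IsComplex w}, BorelSpace (archLocal L 2 (Matrix.diagonal α) w)]
  [∀ w : {w : InfinitePlace L // IsComplex w}, SecondCountableTopology (archLocal L 2 (Matrix.diagonal α) w)]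

open scoped Classical in
/-- **HARISH-CHANDRA'S RANK-ONE LIMIT FORMULA FOR MIXED PARTIAL ORBITAL TEST FUNCTIONS, SIGNED** (★ (R1G)-signed ∘ ★ (R1-a); ★ p841432 §1 with `C < 0`).  For `α : Fin 2 → L` with `α_i ≠ 0`, a complex place `w₀` at which
`σ_{w₀}α` is real with `e₀e₁ < 0` (`G_{w₀} ≅ U(1,1)`), and a Haar measure `μ₀` on `G_{w₀}`, there is `C < 0` such that for ALL measures `μ_{w′}` (`w′ ≠ w₀`) finite on compacts and
σ-finite, all `Θ : M₂(L ⊗ ℝ) → E` smooth with `g ↦ Θ ↑↑g` compactly supported on `G_∞`, and all `z ∈ S¹`: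
`∂_ψ [2 sin ψ · ∫_{G_{w₀}} ∫ Θ ↑↑e⁻¹(k·diag(z e^{iψ}, z e^{−iψ})·k⁻¹, o) d(⊗μ_{w′})(o) dμ₀(k)] → C • ∫ Θ ↑↑e⁻¹(diag(z, z), o) d(⊗μ_{w′})(o)` as `ψ → 0`, `ψ ≠ 0`,
the function being differentiable at every `0 < |ψ| < 1`.  (`C` is ★ (R1G)'s constant of `(σ_{w₀}, α, μ₀)`: independent of `μ_{w′}`, `Θ`, `z`.)
[cite: Varadarajan1989, §6.4 Thm. 22] [cite: Rogawski1990, §14.5 p. 238; §8.4 pp. 126–127] [cite: HormanderALPDO1, Thm. 1.1.9, Thm. 1.4.1] -/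
theorem exists_tendsto_deriv_two_sin_smul_integral_integral_insert_neg {E : Type*} [NormedAddCommGroup E] [NormedSpace ℝ E] [CompleteSpace E]
    (hα : ∀ i, α i ≠ 0) (w₀ : {w : InfinitePlace L // IsComplex w})
    (hreal : ∀ i, (w₀.1.embedding (α i)).im = 0) (hsgn : (w₀.1.embedding (α 0)).re * (w₀.1.embedding (α 1)).re < 0)
    (μ₀ : Measure (archLocal L 2 (Matrix.diagonal α) w₀)) [hμ₀ : μ₀.IsHaarMeasure] :
    ∃ C : ℝ, C < 0 ∧
      ∀ (μ : ∀ w' : {w : {w : InfinitePlace L // IsComplex w} // ¬ w = w₀}, Measure (archLocal L 2 (Matrix.diagonal α) w'.1))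
        [∀ w', IsFiniteMeasureOnCompacts (μ w')] [∀ w', SigmaFinite (μ w')]
        (Θ : Matrix (Fin 2) (Fin 2) (mixedSpace L) → E), ContDiff ℝ (⊤ : ℕ∞) Θ →
        HasCompactSupport (fun g : arch (↥(maximalRealSubfield L)) L (IsCMField.complexConj L) 2 (Matrix.diagonal α) =>
          Θ ((g : GL (Fin 2) (mixedSpace L)) : Matrix (Fin 2) (Fin 2) (mixedSpace L))) →
        ∀ z : Circle,
          Tendsto (fun ψ : ℝ => deriv (fun ψ : ℝ => (2 * Real.sin ψ) •
              ∫ k : archLocal L 2 (Matrix.diagonal α) w₀,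
                ∫ o : (∀ w' : {w : {w : InfinitePlace L // IsComplex w} // ¬ w = w₀}, archLocal L 2 (Matrix.diagonal α) w'.1),
                  Θ ((((archPiEquivCM 2 L (Matrix.diagonal α)).symm
                    ((MeasurableEquiv.piEquivPiSubtypeProd (fun w : {w : InfinitePlace L // IsComplex w} => ↥(archLocal L 2 (Matrix.diagonal α) w)) (· = w₀)).symm
                      ((MeasurableEquiv.piUnique fun i : {w : {w : InfinitePlace L // IsComplex w} // w = w₀} => ↥(archLocal L 2 (Matrix.diagonal α) i.1)).symm
                        (k * ⟨circleDiagonal 2 ![z * Circle.exp ψ, z * Circle.exp (-ψ)], circleDiagonal_mem_archLocal_diagonal L 2 α w₀ _⟩ * k⁻¹), o)) :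
                      arch (↥(maximalRealSubfield L)) L (IsCMField.complexConj L) 2 (Matrix.diagonal α)) : GL (Fin 2) (mixedSpace L)) : Matrix (Fin 2) (Fin 2) (mixedSpace L))
                ∂(Measure.pi μ) ∂μ₀) ψ)
            (𝓝[≠] 0)
            (𝓝 (C • ∫ o : (∀ w' : {w : {w : InfinitePlace L // IsComplex w} // ¬ w = w₀}, archLocal L 2 (Matrix.diagonal α) w'.1),
                  Θ ((((archPiEquivCM 2 L (Matrix.diagonal α)).symm
                    ((MeasurableEquiv.piEquivPiSubtypeProd (fun w : {w : InfinitePlace L // IsComplex w} => ↥(archLocal L 2 (Matrix.diagonal α) w)) (· = w₀)).symm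
                      ((MeasurableEquiv.piUnique fun i : {w : {w : InfinitePlace L // IsComplex w} // w = w₀} => ↥(archLocal L 2 (Matrix.diagonal α) i.1)).symm
                        ⟨circleDiagonal 2 ![z, z], circleDiagonal_mem_archLocal_diagonal L 2 α w₀ _⟩, o)) :
                      arch (↥(maximalRealSubfield L)) L (IsCMField.complexConj L) 2 (Matrix.diagonal α)) : GL (Fin 2) (mixedSpace L)) : Matrix (Fin 2) (Fin 2) (mixedSpace L))
                ∂(Measure.pi μ))) ∧
          ∀ ψ ∈ Ioo (-1 : ℝ) 1, ψ ≠ 0 → DifferentiableAt ℝ (fun ψ : ℝ => (2 * Real.sin ψ) •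
              ∫ k : archLocal L 2 (Matrix.diagonal α) w₀,
                ∫ o : (∀ w' : {w : {w : InfinitePlace L // IsComplex w} // ¬ w = w₀}, archLocal L 2 (Matrix.diagonal α) w'.1),
                  Θ ((((archPiEquivCM 2 L (Matrix.diagonal α)).symm
                    ((MeasurableEquiv.piEquivPiSubtypeProd (fun w : {w : InfinitePlace L // IsComplex w} => ↥(archLocal L 2 (Matrix.diagonal α) w)) (· = w₀)).symm
                      ((MeasurableEquiv.piUnique fun i : {w : {w : InfinitePlace L // IsComplex w} // w = w₀} => ↥(archLocal L 2 (Matrix.diagonal α) i.1)).symm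
                        (k * ⟨circleDiagonal 2 ![z * Circle.exp ψ, z * Circle.exp (-ψ)], circleDiagonal_mem_archLocal_diagonal L 2 α w₀ _⟩ * k⁻¹), o)) :
                      arch (↥(maximalRealSubfield L)) L (IsCMField.complexConj L) 2 (Matrix.diagonal α)) : GL (Fin 2) (mixedSpace L)) : Matrix (Fin 2) (Fin 2) (mixedSpace L))
                ∂(Measure.pi μ) ∂μ₀) ψ := by
  -- ★ (R1G) on `G_{w₀} = U(σ_{w₀}, σ_{w₀} diag α)` (= `archLocal L 2 (diag α) w₀` by `rfl`), constant `C` fixed once and for all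
  obtain ⟨C, hC, hlim⟩ := @exists_tendsto_deriv_two_sin_smul_orbitalIntegral_neg E _ _ _ L _ (w₀.1.embedding : L →+* ℂ) α hreal hsgn
    (inferInstance : MeasurableSpace (archLocal L 2 (Matrix.diagonal α) w₀)) (inferInstance : BorelSpace (archLocal L 2 (Matrix.diagonal α) w₀)) μ₀ hμ₀
  refine ⟨C, hC, fun μ _ _ Θ hΘ hΘc z => ?_⟩
  -- ★ (R1-a): the mixed partial integral is a per-place test function `Θ'` on `G_{w₀}` …
  obtain ⟨Θ', hΘ', hΘ'c, hΘ'eq⟩ := exists_contDiff_eq_integral_insert L 2 α hα w₀ μ Θ hΘ hΘc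
  -- … and ★ cutoff makes it an AMBIENT test function `Θ''` on `M₂(ℂ)` agreeing with `Θ'` on the group
  have hι : Continuous fun k : archLocal L 2 (Matrix.diagonal α) w₀ => ((k : GL (Fin 2) ℂ) : Matrix (Fin 2) (Fin 2) ℂ) :=
    Units.continuous_val.comp continuous_subtype_val
  obtain ⟨Θ'', hΘ'', hΘ''c, -, hΘ''eq⟩ := Literature.Analysis.Calculus.exists_contDiff_hasCompactSupport_comp_eq hι hΘ' hΘ'c
  have hΘ''eq' : ∀ x : archLocal L 2 (Matrix.diagonal α) w₀,
      Θ'' ((x : GL (Fin 2) ℂ) : Matrix (Fin 2) (Fin 2) ℂ) = Θ' ((x : GL (Fin 2) ℂ) : Matrix (Fin 2) (Fin 2) ℂ) := fun x => hΘ''eq x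
  -- ★ (R1G) for `Θ''`
  obtain ⟨h1, h2⟩ := hlim Θ'' (hΘ''.of_le (by exact_mod_cast le_top)) hΘ''c z
  -- the central value `z•1 = ↑↑diag(z, z)`
  have hz1 : ((z : ℂ) • (1 : Matrix (Fin 2) (Fin 2) ℂ)) =
      (((⟨circleDiagonal 2 ![z, z], circleDiagonal_mem_archLocal_diagonal L 2 α w₀ _⟩ : archLocal L 2 (Matrix.diagonal α) w₀) : GL (Fin 2) ℂ) :
        Matrix (Fin 2) (Fin 2) ℂ) := by
    rw [Matrix.smul_one_eq_diagonal]
    show _ = ((circleDiagonal 2 ![z, z] : GL (Fin 2) ℂ) : Matrix (Fin 2) (Fin 2) ℂ)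
    rw [coe_circleDiagonal]
    congr 1
    funext i
    fin_cases i <;> rfl
  -- identify ★ (R1G)'s integrand and value with ours
  have eF : (fun ψ : ℝ => (2 * Real.sin ψ) •
      ∫ k : archLocal L 2 (Matrix.diagonal α) w₀,
        ∫ o : (∀ w' : {w : {w : InfinitePlace L // IsComplex w} // ¬ w = w₀}, archLocal L 2 (Matrix.diagonal α) w'.1),
          Θ ((((archPiEquivCM 2 L (Matrix.diagonal α)).symm
            ((MeasurableEquiv.piEquivPiSubtypeProd (fun w : {w : InfinitePlace L // IsComplex w} => ↥(archLocal L 2 (Matrix.diagonal α) w)) (· = w₀)).symm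
              ((MeasurableEquiv.piUnique fun i : {w : {w : InfinitePlace L // IsComplex w} // w = w₀} => ↥(archLocal L 2 (Matrix.diagonal α) i.1)).symm
                (k * ⟨circleDiagonal 2 ![z * Circle.exp ψ, z * Circle.exp (-ψ)], circleDiagonal_mem_archLocal_diagonal L 2 α w₀ _⟩ * k⁻¹), o)) :
              arch (↥(maximalRealSubfield L)) L (IsCMField.complexConj L) 2 (Matrix.diagonal α)) : GL (Fin 2) (mixedSpace L)) : Matrix (Fin 2) (Fin 2) (mixedSpace L))
        ∂(Measure.pi μ) ∂μ₀) =
      fun ψ : ℝ => (2 * Real.sin ψ) •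
        ∫ k : archLocal L 2 (Matrix.diagonal α) w₀,
          Θ'' (((k * ⟨circleDiagonal 2 ![z * Circle.exp ψ, z * Circle.exp (-ψ)], circleDiagonal_mem_archLocal_diagonal L 2 α w₀ _⟩ * k⁻¹ :
            archLocal L 2 (Matrix.diagonal α) w₀) : GL (Fin 2) ℂ) : Matrix (Fin 2) (Fin 2) ℂ) ∂μ₀ := by
    funext ψ
    congr 1
    refine integral_congr_ae (Eventually.of_forall fun k => ?_)
    simp only []
    rw [hΘ''eq', hΘ'eq]
  have eV : (∫ o : (∀ w' : {w : {w : InfinitePlace L // IsComplex w} // ¬ w = w₀}, archLocal L 2 (Matrix.diagonal α) w'.1),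
        Θ ((((archPiEquivCM 2 L (Matrix.diagonal α)).symm
          ((MeasurableEquiv.piEquivPiSubtypeProd (fun w : {w : InfinitePlace L // IsComplex w} => ↥(archLocal L 2 (Matrix.diagonal α) w)) (· = w₀)).symm
            ((MeasurableEquiv.piUnique fun i : {w : {w : InfinitePlace L // IsComplex w} // w = w₀} => ↥(archLocal L 2 (Matrix.diagonal α) i.1)).symm
              ⟨circleDiagonal 2 ![z, z], circleDiagonal_mem_archLocal_diagonal L 2 α w₀ _⟩, o)) :
            arch (↥(maximalRealSubfield L)) L (IsCMField.complexConj L) 2 (Matrix.diagonal α)) : GL (Fin 2) (mixedSpace L)) : Matrix (Fin 2) (Fin 2) (mixedSpace L))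
        ∂(Measure.pi μ)) = Θ'' ((z : ℂ) • (1 : Matrix (Fin 2) (Fin 2) ℂ)) := by
    rw [hz1, hΘ''eq', hΘ'eq]
  refine ⟨?_, fun ψ hψ hψ0 => ?_⟩
  · rw [eF, eV]
    exact h1
  · rw [eF]
    exact h2 ψ hψ hψ0

end Insert

/-! ## §2 The endoscopic 2-block `β₂ = (½, −½)`: the SIGNED one-step formula at EVERY complex place -/

section QuasiSplitTwo

variable (L : Type) [Field L] [NumberField L] [IsCMField L]
  [∀ w : {w : InfinitePlace L // IsComplex w}, MeasurableSpace (archLocal L 2 (Matrix.diagonal ![(2 : L)⁻¹, -(2 : L)⁻¹]) w)]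
  [∀ w : {w : InfinitePlace L // IsComplex w}, BorelSpace (archLocal L 2 (Matrix.diagonal ![(2 : L)⁻¹, -(2 : L)⁻¹]) w)]
  [∀ w : {w : InfinitePlace L // IsComplex w}, SecondCountableTopology (archLocal L 2 (Matrix.diagonal ![(2 : L)⁻¹, -(2 : L)⁻¹]) w)]

open scoped Classical in
/-- **THE SIGNED ONE-STEP FORMULA ON THE ENDOSCOPIC 2-BLOCK AT EVERY PLACE** (`C < 0`): §1 for `α = β₂ = (½, −½)` (★ (R3-a): `σ_wβ₂` real with `re σ_w(½)·re σ_w(−½) < 0` at every complex `w`,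
so `U(½,−½)_w ≅ U(1,1)` everywhere — the `H`-side of (4.3.1) is NONCOMPACT at every place and Harish-Chandra's limit formula runs at each of them).
[cite: Varadarajan1989, §6.4 Thm. 22] [cite: Rogawski1990, §14.5 p. 238; §4.9 p. 54] -/
theorem exists_tendsto_deriv_two_sin_smul_integral_integral_insert_quasiSplitTwo_neg {E : Type*} [NormedAddCommGroup E] [NormedSpace ℝ E] [CompleteSpace E]
    (w₀ : {w : InfinitePlace L // IsComplex w}) (μ₀ : Measure (archLocal L 2 (Matrix.diagonal ![(2 : L)⁻¹, -(2 : L)⁻¹]) w₀)) [μ₀.IsHaarMeasure] :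
    ∃ C : ℝ, C < 0 ∧
      ∀ (μ : ∀ w' : {w : {w : InfinitePlace L // IsComplex w} // ¬ w = w₀}, Measure (archLocal L 2 (Matrix.diagonal ![(2 : L)⁻¹, -(2 : L)⁻¹]) w'.1))
        [∀ w', IsFiniteMeasureOnCompacts (μ w')] [∀ w', SigmaFinite (μ w')]
        (Θ : Matrix (Fin 2) (Fin 2) (mixedSpace L) → E), ContDiff ℝ (⊤ : ℕ∞) Θ →
        HasCompactSupport (fun g : arch (↥(maximalRealSubfield L)) L (IsCMField.complexConj L) 2 (Matrix.diagonal ![(2 : L)⁻¹, -(2 : L)⁻¹]) =>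
          Θ ((g : GL (Fin 2) (mixedSpace L)) : Matrix (Fin 2) (Fin 2) (mixedSpace L))) →
        ∀ z : Circle,
          Tendsto (fun ψ : ℝ => deriv (fun ψ : ℝ => (2 * Real.sin ψ) •
              ∫ k : archLocal L 2 (Matrix.diagonal ![(2 : L)⁻¹, -(2 : L)⁻¹]) w₀,
                ∫ o : (∀ w' : {w : {w : InfinitePlace L // IsComplex w} // ¬ w = w₀}, archLocal L 2 (Matrix.diagonal ![(2 : L)⁻¹, -(2 : L)⁻¹]) w'.1),
                  Θ ((((archPiEquivCM 2 L (Matrix.diagonal ![(2 : L)⁻¹, -(2 : L)⁻¹])).symm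
                    ((MeasurableEquiv.piEquivPiSubtypeProd (fun w : {w : InfinitePlace L // IsComplex w} => ↥(archLocal L 2 (Matrix.diagonal ![(2 : L)⁻¹, -(2 : L)⁻¹]) w)) (· = w₀)).symm
                      ((MeasurableEquiv.piUnique fun i : {w : {w : InfinitePlace L // IsComplex w} // w = w₀} => ↥(archLocal L 2 (Matrix.diagonal ![(2 : L)⁻¹, -(2 : L)⁻¹]) i.1)).symm
                        (k * ⟨circleDiagonal 2 ![z * Circle.exp ψ, z * Circle.exp (-ψ)], circleDiagonal_mem_archLocal_diagonal L 2 ![(2 : L)⁻¹, -(2 : L)⁻¹] w₀ _⟩ * k⁻¹), o)) :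
                      arch (↥(maximalRealSubfield L)) L (IsCMField.complexConj L) 2 (Matrix.diagonal ![(2 : L)⁻¹, -(2 : L)⁻¹])) : GL (Fin 2) (mixedSpace L)) :
                      Matrix (Fin 2) (Fin 2) (mixedSpace L))
                ∂(Measure.pi μ) ∂μ₀) ψ)
            (𝓝[≠] 0)
            (𝓝 (C • ∫ o : (∀ w' : {w : {w : InfinitePlace L // IsComplex w} // ¬ w = w₀}, archLocal L 2 (Matrix.diagonal ![(2 : L)⁻¹, -(2 : L)⁻¹]) w'.1),
                  Θ ((((archPiEquivCM 2 L (Matrix.diagonal ![(2 : L)⁻¹, -(2 : L)⁻¹])).symm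
                    ((MeasurableEquiv.piEquivPiSubtypeProd (fun w : {w : InfinitePlace L // IsComplex w} => ↥(archLocal L 2 (Matrix.diagonal ![(2 : L)⁻¹, -(2 : L)⁻¹]) w)) (· = w₀)).symm
                      ((MeasurableEquiv.piUnique fun i : {w : {w : InfinitePlace L // IsComplex w} // w = w₀} => ↥(archLocal L 2 (Matrix.diagonal ![(2 : L)⁻¹, -(2 : L)⁻¹]) i.1)).symm
                        ⟨circleDiagonal 2 ![z, z], circleDiagonal_mem_archLocal_diagonal L 2 ![(2 : L)⁻¹, -(2 : L)⁻¹] w₀ _⟩, o)) :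
                      arch (↥(maximalRealSubfield L)) L (IsCMField.complexConj L) 2 (Matrix.diagonal ![(2 : L)⁻¹, -(2 : L)⁻¹])) : GL (Fin 2) (mixedSpace L)) :
                      Matrix (Fin 2) (Fin 2) (mixedSpace L))
                ∂(Measure.pi μ))) ∧
          ∀ ψ ∈ Ioo (-1 : ℝ) 1, ψ ≠ 0 → DifferentiableAt ℝ (fun ψ : ℝ => (2 * Real.sin ψ) •
              ∫ k : archLocal L 2 (Matrix.diagonal ![(2 : L)⁻¹, -(2 : L)⁻¹]) w₀,
                ∫ o : (∀ w' : {w : {w : InfinitePlace L // IsComplex w} // ¬ w = w₀}, archLocal L 2 (Matrix.diagonal ![(2 : L)⁻¹, -(2 : L)⁻¹]) w'.1),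
                  Θ ((((archPiEquivCM 2 L (Matrix.diagonal ![(2 : L)⁻¹, -(2 : L)⁻¹])).symm
                    ((MeasurableEquiv.piEquivPiSubtypeProd (fun w : {w : InfinitePlace L // IsComplex w} => ↥(archLocal L 2 (Matrix.diagonal ![(2 : L)⁻¹, -(2 : L)⁻¹]) w)) (· = w₀)).symm
                      ((MeasurableEquiv.piUnique fun i : {w : {w : InfinitePlace L // IsComplex w} // w = w₀} => ↥(archLocal L 2 (Matrix.diagonal ![(2 : L)⁻¹, -(2 : L)⁻¹]) i.1)).symm
                        (k * ⟨circleDiagonal 2 ![z * Circle.exp ψ, z * Circle.exp (-ψ)], circleDiagonal_mem_archLocal_diagonal L 2 ![(2 : L)⁻¹, -(2 : L)⁻¹] w₀ _⟩ * k⁻¹), o)) :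
                      arch (↥(maximalRealSubfield L)) L (IsCMField.complexConj L) 2 (Matrix.diagonal ![(2 : L)⁻¹, -(2 : L)⁻¹])) : GL (Fin 2) (mixedSpace L)) :
                      Matrix (Fin 2) (Fin 2) (mixedSpace L))
                ∂(Measure.pi μ) ∂μ₀) ψ :=
  exists_tendsto_deriv_two_sin_smul_integral_integral_insert_neg L ![(2 : L)⁻¹, -(2 : L)⁻¹] (quasiSplitWeightsTwo_ne_zero L) w₀
    (im_embedding_quasiSplitWeightsTwo_eq_zero L w₀) (re_embedding_quasiSplitWeightsTwo_mul_neg L w₀) μ₀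

end QuasiSplitTwo

end Literature.NumberTheory.Automorphic.UnitaryGroup

end
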